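import Summits.HodgeConjecture.HodgeConjecture.Theses.PadicSemiregularLift
import Summits.HodgeConjecture.HodgeConjecture.Theorems.EndoscopicMiddleDegreeCupProductAlgebraic
import HarnessLib

/-!
# Crux `HodgeBeyondAnchors` (stmt-HodgeConjecture-14054), line `andre_variational` — registered stub
# `stub_cupProductAlgebraic`, CLOSED BY NAME

Route `PadicSemiregularLift` of `HodgeConjecture`. The registered skeleton
`Cruxes/HodgeBeyondAnchors/Lines/andre_variational.lean` names as a stub, BY NAME, the Literature named
fact

  `Literature.AlgebraicGeometry.HodgeTheory.Voisin2003_cupProduct_algebraicClasses`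

(Voisin II, Lemma 11.12 ff. / Fulton Ex. 8.3.8: the cup product of algebraic classes of a smooth
projective complex variety is algebraic). That fact is a THEOREM of the tree
(`Theorems.Voisin2003_cupProduct_algebraicClasses_holds`, `Theorems/EndoscopicMiddleDegreeCupProductAlgebraic.lean`:
exterior product of algebraic classes + pull-back along the diagonal by the landed Fulton Cor. 19.2 (b)),
landed after the skeleton was registered and never credited to this crux's stub (the flat name
`Theorems.stub_cupProductAlgebraic` belongs to crux `AlgebraicOrEnveloped`, whose copy of the stub — the
route item `EndoscopicMiddleDegree.CupProductAlgebraic` — is credited; hence the sub-namespace here). This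
file records the registered signature. No mathematics beyond the citation of the tree theorem.

## References

* [VoisinHodgeII2003] C. Voisin, Hodge Theory and Complex Algebraic Geometry II (2003), §9.2 Prop. 9.20–9.21
  and §11.1.2.
* [Fulton1998] W. Fulton, Intersection Theory, 2nd ed. (1998), Ex. 8.3.8, Cor. 19.2 (b).
-/

noncomputable section

-- `Summit.HodgeConjecture.HodgeConjecture.…` is the mandated namespace (single-conjunct summit).
set_option linter.dupNamespace false

namespace Summit.HodgeConjecture.HodgeConjecture.Theorems.HodgeBeyondAnchors

/-- **Registered stub `stub_cupProductAlgebraic` of the line `andre_variational`** (crux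
`HodgeBeyondAnchors`, stmt-HodgeConjecture-14054), verbatim: the named fact
`Voisin2003_cupProduct_algebraicClasses` — on a smooth projective complex variety the cup product of an
algebraic class of codimension `p` and an algebraic class of codimension `q` is algebraic of codimension
`p + q`. Discharged by the tree theorem `Theorems.Voisin2003_cupProduct_algebraicClasses_holds`.
[cite: VoisinHodgeII2003, §9.2 Prop. 9.20–9.21] [cite: Fulton1998, Ex. 8.3.8] -/
theorem stub_cupProductAlgebraic :
    Literature.AlgebraicGeometry.HodgeTheory.Voisin2003_cupProduct_algebraicClasses :=
  Summit.HodgeConjecture.HodgeConjecture.Theorems.Voisin2003_cupProduct_algebraicClasses_holds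

end Summit.HodgeConjecture.HodgeConjecture.Theorems.HodgeBeyondAnchors

end
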